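import Mathlib.Tactic
import HarnessLib
import Summits.CriticalPhenomena.PercolationContinuityZ3.Theorems.PercNearOneGluingNoHeavyLowerTailKnQuestion8UnifThreeAssembly

/-!
# Kozma–Nitzan's Question 8 at three relays — THEOREM (RC-G3): the universal k = 3 step of the uniform form (gen 32)

Support file (`--supports stmt-CriticalPhenomena-4575`, closed crux; independent mathematics on Kozma–Nitzan's Question 8,
arXiv:2401.12397 §5.5 p. 36), prover `prim-ineq-gen-6` (gen 32).  No definitions, no named facts, no sorries; standard axioms.
Memo `run/shared/lean/prim/prim-ineq-gen-6/PROOF-RCG3-G32.md` (complete proof; this file is its §1 assembly).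

`k3_rcg3` is gen 31's reduced k = 3 problem (RC-G3) (`lab-g31/v38_k3reduced.py`, FINDING-G31 §5g) — the merge step (M′) of the
uniform form UNIF-G at a first crossing k = 3, in vertex-1 / vertex-2 / far-side coordinates — multiplied through by the positive
normaliser `p·p₀·P_F·A·a`.  Ingredients: the observer-lens bound `k3_vt_bound`, the prefix excess `k3_n3prefix`, and the
normalised core `k3_club_un` ⟸ `k3_diamond_un` ⟸ `k3_diamond` ⟸ `k3_diamond1` ⟸ the four polynomial cores.  Together with the
k = 2 step (`rcg_k2_caseAC`, `rcg_k2_caseCA`, gen 31) and `merge_induction` this is UNIF-G for every block and every k ≤ 3.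
[cite: KozmaNitzan2024, Question 8 (§5.5 p. 36)]
-/

namespace Summit.CriticalPhenomena.PercolationContinuityZ3.Theorems

namespace PocketCert

set_option maxHeartbeats 1600000 in
/-- **THEOREM (RC-G3) — the universal k = 3 step of the uniform form** (PROOF-RCG3-G32; FINDING-G31 §5g), in the reduced
variables of gen 31's `lab-g31/v38_k3reduced.py` and multiplied through by the positive normaliser `p·p₀·P_F·A·a`.
Vertex 1 (marks `A, C`, edge weight `s`, depth-0 weight `w ≤ 1−λ`), vertex 2 (marks `a, c`, edge weight `σ`, `λ′₂ = (1+λ)Cc − 1 ≥ 0`),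
far side `F = T₃` rooted at the crossing vertex (channels `u_F, v_F, m_F`, `P_F ≤ 1`, `D_F = 1 − P_F`, crossing defect `δ ≥ λ′₂` with
`v_F ≥ δ·m_F`, `D_F ≥ δ·u_F`); the aggregates of `T₂` and `T₁` are the displayed polynomials.  Then NEED ≤ KILL, i.e. the merge step (M′)
holds at every first crossing `k = 3` for every block, every `λ ∈ (0,1)` and every `w ∈ [0,1−λ]`; with `merge_induction` (p327779) and the
k = 2 step (`rcg_k2_caseAC/CA`) this is the uniform form UNIF-G for all `k ≤ 3`.  (Chebyshev `D_F·m_F ≥ u_F·v_F` is not needed.)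
[cite: KozmaNitzan2024, Question 8 (§5.5 p. 36)] -/
theorem k3_rcg3 (lam A C s w a c sig uF vF mF dl PF DF mt u v m p q M₁ p0 v1 m1 lamp2 d y z : ℝ)
    (hl0 : 0 < lam) (hl1 : lam < 1) (hA0 : 0 < A) (hA1 : A ≤ 1) (hC0 : 0 < C) (hC1 : C ≤ 1)
    (hs0 : 0 ≤ s) (hs1 : s ≤ 1) (hw0 : 0 ≤ w) (hw1 : w ≤ 1 - lam) (ha0 : 0 < a) (ha1 : a ≤ 1) (hc0 : 0 < c) (hc1 : c ≤ 1)
    (hW : 1 ≤ (1 + lam) * C * c) (hsig0 : 0 ≤ sig) (hsig1 : sig ≤ 1) (huF : 0 ≤ uF) (hvF : 0 ≤ vF) (hmF : 0 ≤ mF)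
    (hPF : PF = uF + vF + mF) (hPFpos : 0 < PF) (hPF1 : PF ≤ 1) (hDF : DF = 1 - PF)
    (hlamp2 : lamp2 = (1 + lam) * C * c - 1) (hdl : lamp2 ≤ dl) (hF1 : dl * mF ≤ vF) (hF2 : dl * uF ≤ DF)
    (hmt : mt = (1 - sig) * PF + sig * mF) (hu : u = c * ((1 - a) * mt + sig * uF)) (hv : v = a * ((1 - c) * mt + sig * vF))
    (hm : m = a * c * mt) (hp : p = u + v + m) (hq : q = (1 - s) * p + s * m) (hM : M₁ = A + C - A * C)
    (hp0 : p0 = M₁ * q + s * C * u + s * A * v) (hv1 : v1 = A * ((1 - C) * q + s * v)) (hm1 : m1 = A * C * q)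
    (hd : d = DF + (1 - a) * (1 - c) * PF) (hy : y = lamp2 * (1 - A * a) * PF - DF)
    (hz : z = s * ((lamp2 + lam * (A - C) * c) * (1 - a) * PF - DF) - (1 - s) * M₁ * d) :
    (1 - sig) * (w * v1 * y * (p * PF * A * a) + C * v * z * (p0 * PF * A * a))
      ≤ (1 - sig) * (C * c * vF * (3 / 4 * (1 - A * a) + (1 - M₁ * p) * (A * a)) * (p * p0)
            + A * C * p * (1 - C * c) * lam ^ 2 * uF * (p * p0 * A * a))
        + (1 - C) * lam ^ 2 * m1 * u * (p0 * PF * A * a) := by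
  -- ν := (1−c)m̃ + σ v_F,  X := v_F + m_F
  have hlamp2_0 : 0 ≤ lamp2 := by rw [hlamp2]; linarith
  have hDF0 : 0 ≤ DF := by rw [hDF]; linarith
  have h1a : 0 ≤ 1 - a := by linarith
  have h1A : 0 ≤ 1 - A := by linarith
  have h1c : 0 ≤ 1 - c := by linarith
  have h1C : 0 ≤ 1 - C := by linarith
  have h1s : 0 ≤ 1 - s := by linarith
  have h1sig : 0 ≤ 1 - sig := by linarith
  have hmt0 : 0 ≤ mt := by
    rw [hmt]; have := mul_nonneg h1sig hPFpos.le; have := mul_nonneg hsig0 hmF; linarith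
  have hmtsig : sig * mF ≤ mt := by rw [hmt]; have := mul_nonneg h1sig hPFpos.le; linarith
  have hnu0 : 0 ≤ (1 - c) * mt + sig * vF := by
    have := mul_nonneg h1c hmt0; have := mul_nonneg hsig0 hvF; linarith
  have hv0 : 0 ≤ v := by rw [hv]; exact mul_nonneg ha0.le hnu0
  have hu0 : 0 ≤ u := by
    rw [hu]; have := mul_nonneg h1a hmt0; have := mul_nonneg hsig0 huF
    exact mul_nonneg hc0.le (by linarith)
  have hm0 : 0 ≤ m := by rw [hm]; exact mul_nonneg (mul_nonneg ha0.le hc0.le) hmt0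
  have hp0' : 0 ≤ p := by rw [hp]; linarith
  have hM0 : 0 ≤ M₁ := by
    have e : M₁ = C + A * (1 - C) := by rw [hM]; ring
    rw [e]; have := mul_nonneg hA0.le h1C; linarith
  have hMA : A ≤ M₁ := by
    have e : M₁ = A + C * (1 - A) := by rw [hM]; ring
    rw [e]; have := mul_nonneg hC0.le h1A; linarith
  have hCM : C ≤ M₁ := by
    have e : M₁ = C + A * (1 - C) := by rw [hM]; ring
    rw [e]; have := mul_nonneg hA0.le h1C; linarith
  have hpm : m ≤ p := by rw [hp]; linarith
  have hq0 : 0 ≤ q := by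
    rw [hq]; have := mul_nonneg h1s hp0'; have := mul_nonneg hs0 hm0; linarith
  have hqm : a * c * mt ≤ q := by
    have e : q - a * c * mt = (1 - s) * (p - m) := by rw [hq, hm]; ring
    have t := mul_nonneg h1s (sub_nonneg.mpr hpm)
    linarith
  have hp00 : 0 ≤ p0 := by
    rw [hp0]; have := mul_nonneg hM0 hq0; have := mul_nonneg (mul_nonneg hs0 hC0.le) hu0
    have := mul_nonneg (mul_nonneg hs0 hA0.le) hv0; linarith
  have hv10 : 0 ≤ v1 := by
    rw [hv1]; have := mul_nonneg h1C hq0; have := mul_nonneg hs0 hv0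
    exact mul_nonneg hA0.le (by linarith)
  have hm10 : 0 ≤ m1 := by rw [hm1]; exact mul_nonneg (mul_nonneg hA0.le hC0.le) hq0
  have hd0 : 0 ≤ d := by
    rw [hd]; have := mul_nonneg (mul_nonneg h1a h1c) hPFpos.le; linarith
  have hAa1 : A * a ≤ 1 := by
    have := mul_le_mul hA1 ha1 ha0.le (by norm_num : (0:ℝ) ≤ 1); linarith
  have hAa0 : 0 ≤ A * a := mul_nonneg hA0.le ha0.le
  have hCc1 : C * c ≤ 1 := by
    have := mul_le_mul hC1 hc1 hc0.le (by norm_num : (0:ℝ) ≤ 1); linarith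
  -- (B) need bounds:  y ≤ λ′₂(1−Aa)X,   z ≤ s(1−a)(λ′₂X + λ(A−C)cP_F)
  have hlu : lamp2 * uF ≤ DF := le_trans (mul_le_mul_of_nonneg_right hdl huF) hF2
  have hlm : lamp2 * mF ≤ vF := le_trans (mul_le_mul_of_nonneg_right hdl hmF) hF1
  have hyb : y ≤ lamp2 * (1 - A * a) * (vF + mF) := by
    have e : y = lamp2 * (1 - A * a) * (vF + mF) + ((1 - A * a) * (lamp2 * uF) - DF) := by rw [hy, hPF]; ring
    have t1 : (1 - A * a) * (lamp2 * uF) ≤ (1 - A * a) * DF := mul_le_mul_of_nonneg_left hlu (sub_nonneg.mpr hAa1)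
    have t2 : (1 - A * a) * DF ≤ DF := by
      have e2 : (1 - A * a) * DF = DF - (A * a) * DF := by ring
      linarith [mul_nonneg hAa0 hDF0]
    linarith
  have hzb : z ≤ s * (1 - a) * (lamp2 * (vF + mF) + lam * (A - C) * c * PF) := by
    have e : z = s * (1 - a) * (lamp2 * (vF + mF) + lam * (A - C) * c * PF)
        + (s * ((1 - a) * (lamp2 * uF) - DF) - (1 - s) * M₁ * d) := by rw [hz, hPF]; ring
    have t1 : (1 - a) * (lamp2 * uF) ≤ (1 - a) * DF := mul_le_mul_of_nonneg_left hlu h1a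
    have t2 : (1 - a) * DF ≤ DF := by
      have e2 : (1 - a) * DF = DF - a * DF := by ring
      linarith [mul_nonneg ha0.le hDF0]
    have t3 : s * ((1 - a) * (lamp2 * uF) - DF) ≤ 0 := mul_nonpos_of_nonneg_of_nonpos hs0 (by linarith)
    have t4 : 0 ≤ (1 - s) * M₁ * d := mul_nonneg (mul_nonneg h1s hM0) hd0
    linarith
  -- INNER ≤ TERM-A + TERM-a  (positivity of the multipliers)
  have hK1 : 0 ≤ p * PF * A * a := by positivity
  have hK2 : 0 ≤ p0 * PF * A * a := by positivity
  have hN1 : w * v1 * y * (p * PF * A * a) ≤ w * v1 * (lamp2 * (1 - A * a) * (vF + mF)) * (p * PF * A * a) :=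
    mul_le_mul_of_nonneg_right (mul_le_mul_of_nonneg_left hyb (mul_nonneg hw0 hv10)) hK1
  have hN2 : C * v * z * (p0 * PF * A * a)
      ≤ C * v * (s * (1 - a) * (lamp2 * (vF + mF) + lam * (A - C) * c * PF)) * (p0 * PF * A * a) :=
    mul_le_mul_of_nonneg_right (mul_le_mul_of_nonneg_left hzb (mul_nonneg hC0.le hv0)) hK2
  -- (C) the observer-lens corollary:  w·v₁·λ′₂·X ≤ p₀·(1−λ)λ·Cc·v_F
  have hvt := k3_vt_bound A C s u a c sig mt vF mF q M₁ hA0.le hC0.le hC1 hMA hs0 hs1 hu0 ha0.le hc0.le hc1 hsig0 hvF hmF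
    hmt0 hmtsig hqm
  have hvt' : v1 * (mF + vF) ≤ p0 * ((1 - C * c) * mF + vF) := by rw [hv1, hp0, hv]; exact hvt
  have hcor : w * v1 * (lamp2 * (vF + mF)) ≤ p0 * ((1 - lam) * lam * C * c * vF) := by
    have s1 : v1 * (lamp2 * (vF + mF)) ≤ p0 * (lamp2 * ((1 - C * c) * mF + vF)) := by
      have := mul_le_mul_of_nonneg_left hvt' hlamp2_0
      have e1 : lamp2 * (v1 * (mF + vF)) = v1 * (lamp2 * (vF + mF)) := by ring
      have e2 : lamp2 * (p0 * ((1 - C * c) * mF + vF)) = p0 * (lamp2 * ((1 - C * c) * mF + vF)) := by ring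
      linarith [e1, e2]
    have s2 : lamp2 * ((1 - C * c) * mF + vF) ≤ lam * C * c * vF := by
      have t : (1 - C * c) * (lamp2 * mF) ≤ (1 - C * c) * vF := mul_le_mul_of_nonneg_left hlm (sub_nonneg.mpr hCc1)
      have e1 : lamp2 * ((1 - C * c) * mF + vF) = (1 - C * c) * (lamp2 * mF) + lamp2 * vF := by ring
      have e2 : (1 - C * c) * vF + lamp2 * vF = lam * C * c * vF := by rw [hlamp2]; ring
      linarith [e1, e2]
    have s3 : v1 * (lamp2 * (vF + mF)) ≤ p0 * (lam * C * c * vF) := le_trans s1 (mul_le_mul_of_nonneg_left s2 hp00)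
    have s4 : 0 ≤ v1 * (lamp2 * (vF + mF)) := mul_nonneg hv10 (mul_nonneg hlamp2_0 (by linarith))
    have s5 := mul_le_mul hw1 s3 s4 (by linarith)
    have e : (1 - lam) * (p0 * (lam * C * c * vF)) = p0 * ((1 - lam) * lam * C * c * vF) := by ring
    linarith [e]
  -- (D) TERM-A ≤ (1−A)-share of the R-kill
  have hTA : w * v1 * (lamp2 * ((1 - A) * (vF + mF))) * (p * PF * A * a) ≤ C * c * vF * (3 / 4 * (1 - A)) * (p * p0) := by
    have s1 : w * v1 * (lamp2 * ((1 - A) * (vF + mF))) * (p * PF * A * a)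
        = (1 - A) * ((w * v1 * (lamp2 * (vF + mF))) * (p * PF * A * a)) := by ring
    have s2 : (w * v1 * (lamp2 * (vF + mF))) * (p * PF * A * a) ≤ (p0 * ((1 - lam) * lam * C * c * vF)) * (p * PF * A * a) :=
      mul_le_mul_of_nonneg_right hcor hK1
    have s3 : (p0 * ((1 - lam) * lam * C * c * vF)) * (p * PF * A * a) ≤ C * c * vF * (3 / 4) * (p * p0) := by
      have hll : (1 - lam) * lam ≤ 1 / 4 := by
        have e : (1 - lam) * lam = 1 / 4 - (lam - 1 / 2) ^ 2 := by ring
        linarith [sq_nonneg (lam - 1 / 2)]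
      have hPAa : PF * (A * a) ≤ 1 := by
        have := mul_le_mul hPF1 hAa1 hAa0 (by norm_num : (0:ℝ) ≤ 1); linarith
      have base : 0 ≤ p0 * (C * c * vF) * p := by positivity
      have e1 : (p0 * ((1 - lam) * lam * C * c * vF)) * (p * PF * A * a)
          = ((1 - lam) * lam) * (PF * (A * a)) * (p0 * (C * c * vF) * p) := by ring
      have e2 : C * c * vF * (3 / 4) * (p * p0) = (3 / 4 : ℝ) * (p0 * (C * c * vF) * p) := by ring
      have f1 : ((1 - lam) * lam) * (PF * (A * a)) ≤ 1 / 4 * 1 :=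
        mul_le_mul hll hPAa (by positivity) (by norm_num)
      have f2 := mul_le_mul_of_nonneg_right f1 base
      rw [e1, e2]; linarith
    rw [s1]
    have s4 := mul_le_mul_of_nonneg_left (le_trans s2 s3) h1A
    have e : (1 - A) * (C * c * vF * (3 / 4) * (p * p0)) = C * c * vF * (3 / 4 * (1 - A)) * (p * p0) := by ring
    linarith [e]
  -- (E) TERM-a.  E1: the depth-0 observer on the vertex-2 defect
  have hE1 : w * v1 * (lamp2 * (A * (vF + mF))) * (p * PF * A * a)
      ≤ A * (p0 * ((1 - lam) * lam * C * c * vF)) * (p * PF * A * a) := by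
    have e : w * v1 * (lamp2 * (A * (vF + mF))) * (p * PF * A * a)
        = A * ((w * v1 * (lamp2 * (vF + mF))) * (p * PF * A * a)) := by ring
    have e2 : A * (p0 * ((1 - lam) * lam * C * c * vF)) * (p * PF * A * a)
        = A * ((p0 * ((1 - lam) * lam * C * c * vF)) * (p * PF * A * a)) := by ring
    rw [e, e2]
    exact mul_le_mul_of_nonneg_left (mul_le_mul_of_nonneg_right hcor hK1) hA0.le
  have hE1' := mul_le_mul_of_nonneg_left hE1 h1a
  -- E3: prefix part of N3 ≤ its share of LL′
  have hE3 := k3_n3prefix lam A C s a c mt q hl0 hA0.le hA1 hC0.le hC1 hW hs0 hs1 ha0.le hc0.le hc1 hmt0 hqm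
  have hE3s : C * (a * ((1 - c) * mt)) * (s * (1 - a) * (lam * (A - C) * c * PF)) * (p0 * PF * A * a)
      ≤ (1 - a) * ((1 - C) * lam ^ 2 * m1 * (c * PF) * (p0 * PF * A * a)) := by
    have hfac : 0 ≤ lam * C * c * PF * (1 - a) * (p0 * PF * A * a) := by positivity
    have t := mul_le_mul_of_nonneg_right hE3 hfac
    have e1 : s * a * (1 - c) * mt * (A - C) * (lam * C * c * PF * (1 - a) * (p0 * PF * A * a))
        = C * (a * ((1 - c) * mt)) * (s * (1 - a) * (lam * (A - C) * c * PF)) * (p0 * PF * A * a) := by ring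
    have e2 : (1 - C) * lam * A * q * (lam * C * c * PF * (1 - a) * (p0 * PF * A * a))
        = (1 - a) * ((1 - C) * lam ^ 2 * m1 * (c * PF) * (p0 * PF * A * a)) := by rw [hm1]; ring
    linarith [e1, e2]
  -- E4: (♣-un) × (1−a)·C·p0·A
  have hPFpos' : 0 < uF + vF + mF := by rw [← hPF]; exact hPFpos
  have hPF1' : uF + vF + mF ≤ 1 := by rw [← hPF]; exact hPF1
  have hcross : ((1 + lam) * C * c - 1) * mF ≤ vF := by rw [← hlamp2]; exact hlm
  have hclub := k3_club_un lam A C s a c sig uF vF mF M₁ hl0 hl1 hA1 ha0.le ha1 hc0 hc1 hC1 hCM hW hs0 hs1 hsig0 hsig1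
    huF hvF hmF hPFpos' hPF1' hcross
  have hnu : (1 - c) * ((uF + vF + mF) - sig * uF) + c * sig * vF = (1 - c) * mt + sig * vF := by rw [hmt, hPF]; ring
  rw [hnu] at hclub
  have hpp : c * ((uF + vF + mF) - sig * vF) + a * ((1 - c) * mt + sig * vF) = p := by
    rw [hp, hu, hv, hm, hmt, hPF]; ring
  rw [hpp, ← hPF, ← hlamp2] at hclub
  have hfac2 : 0 ≤ (1 - a) * C * p0 * A := by positivity
  have hE4 := mul_le_mul_of_nonneg_right hclub hfac2
  -- V-kill lower bound
  have hVp : M₁ * ((1 - a) * ((1 - c) * mt + sig * vF)) ≤ 1 - M₁ * p := by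
    have e : 1 - M₁ * p = (1 - A) * (1 - C) + M₁ * (1 - p) := by rw [hM]; ring
    have e2 : 1 - p = DF + sig * (1 - c) * uF + (1 - a) * ((1 - c) * mt + sig * vF) := by
      rw [hp, hu, hv, hm, hmt, hDF, hPF]; ring
    have t0 : 0 ≤ sig * (1 - c) * uF := mul_nonneg (mul_nonneg hsig0 h1c) huF
    have hTp : (1 - a) * ((1 - c) * mt + sig * vF) ≤ 1 - p := by linarith
    have t1 := mul_le_mul_of_nonneg_left hTp hM0
    have t2 := mul_nonneg h1A h1C
    linarith
  have hV : C * c * vF * (M₁ * ((1 - a) * ((1 - c) * mt + sig * vF))) * (A * a) * (p * p0)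
      ≤ C * c * vF * (1 - M₁ * p) * (A * a) * (p * p0) := by
    have base : 0 ≤ C * c * vF := by positivity
    have t1 := mul_le_mul_of_nonneg_left hVp base
    have t2 := mul_le_mul_of_nonneg_right t1 hAa0
    exact mul_le_mul_of_nonneg_right t2 (mul_nonneg hp0' hp00)
  have hL0 : 0 ≤ A * C * p * (1 - C * c) * lam ^ 2 * uF * (p * p0 * A * a) := by
    have : 0 ≤ 1 - C * c := by linarith
    positivity
  -- assemble INNER ≤ R + V + L + LL₀ (exact bookkeeping identity after substituting v = a·ν)
  have hINNER : w * v1 * y * (p * PF * A * a) + C * v * z * (p0 * PF * A * a)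
      ≤ C * c * vF * (3 / 4 * (1 - A * a) + (1 - M₁ * p) * (A * a)) * (p * p0)
        + A * C * p * (1 - C * c) * lam ^ 2 * uF * (p * p0 * A * a)
        + (1 - a) * ((1 - C) * lam ^ 2 * m1 * (c * PF) * (p0 * PF * A * a)) := by
    rw [hv] at hN2 ⊢
    linear_combination hN1 + hN2 + hTA + hE1' + hE3s + hE4 + hV + hL0
  -- (A) LL share: (1−σ)·LL₀ ≤ LL_full, then finish
  have hLL : (1 - sig) * ((1 - a) * ((1 - C) * lam ^ 2 * m1 * (c * PF) * (p0 * PF * A * a)))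
      ≤ (1 - C) * lam ^ 2 * m1 * u * (p0 * PF * A * a) := by
    have hub : (1 - sig) * ((1 - a) * (c * PF)) ≤ u := by
      have e : u = (1 - sig) * ((1 - a) * (c * PF)) + (c * (1 - a) * (sig * mF) + c * (sig * uF)) := by rw [hu, hmt]; ring
      have t1 : 0 ≤ c * (1 - a) * (sig * mF) := mul_nonneg (mul_nonneg hc0.le h1a) (mul_nonneg hsig0 hmF)
      have t2 : 0 ≤ c * (sig * uF) := mul_nonneg hc0.le (mul_nonneg hsig0 huF)
      linarith
    have base : 0 ≤ (1 - C) * lam ^ 2 * m1 * (p0 * PF * A * a) := by positivity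
    have t := mul_le_mul_of_nonneg_left hub base
    have e1 : (1 - C) * lam ^ 2 * m1 * (p0 * PF * A * a) * ((1 - sig) * ((1 - a) * (c * PF)))
        = (1 - sig) * ((1 - a) * ((1 - C) * lam ^ 2 * m1 * (c * PF) * (p0 * PF * A * a))) := by ring
    have e2 : (1 - C) * lam ^ 2 * m1 * (p0 * PF * A * a) * u = (1 - C) * lam ^ 2 * m1 * u * (p0 * PF * A * a) := by ring
    linarith [e1, e2]
  have hfin := mul_le_mul_of_nonneg_left hINNER h1sig
  linear_combination hfin + hLL

end PocketCert

end Summit.CriticalPhenomena.PercolationContinuityZ3.Theorems
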